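import Literature.Barriers.QuantumAdvantage.PPolyOraclesThm76QuantumBounds
import Literature.Barriers.QuantumAdvantage.PPolyOraclesLem75Word
import Literature.Computability.Cryptography.PeriodFindingUniform
import Literature.Computability.Cryptography.OrderFindingPostCF
import HarnessLib

/-!
# Aaronson–Chen 2017, Lemma 7.5 (2)–(3): the classical post-processor of the distinguisher

Companion of `PPolyOraclesThm76.lean` towards the discharge of `aaronsonChen2017_lem75_quantum`
(arXiv:1612.05903, App. 13 p. 42: "apply the period-finding algorithm polynomially many times").
The decision `Found` (`PPolyOraclesThm76QuantumBounds.lean`) on the measured output string `y`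
of the quantum core is a polynomial-time function of `⟨x, y⟩`: for every unit, the block counts
are ones of windows of `y` (`cntU_readOf`, counted by `Lem75Q.strCount` of the sibling `PPolyOraclesLem75Word.lean`), Kitaev's refinement is the integer refinement
`OFPostCF.refineNat` (`phaseEstU_readOf`, as `OFPostCF.phaseEst_eq`), the rounded character is
an integer quotient (`cEst_readOf`), and Shor's candidate is the continued-fraction candidate
`OFPostCF.cfCandidate` (`cand_readOf`, by `OFPostCF.cfCandidate_eq_candidate`); the two-hit
test runs over the pairs of units of each length (`found_iff`). All of this is programmed in the
typed algebra `CodeFP` (`post_fp`), giving the post-processor `postFn n₀ ∈ FP` with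
`postFn n₀ ⟨x, y⟩ = [ |x| < n₀ ∨ ¬ Found ]` (`postFn_mem_FP`, `postFn_apply`).

## References

* [AaronsonChen2017] arXiv:1612.05903, App. 13 (p. 42).
* [Shor1997] SIAM J. Comput. 26 (1997), §5 (continued fractions, polynomial time).
* [Kitaev1995] arXiv:quant-ph/9511026, §3 Lemma 10.
* [AroraBarak2009] §1.3.
-/

noncomputable section

namespace Literature.Barriers.QuantumAdvantage

open _root_.Computability Literature.Computability.Complexity Literature.Computability.Complexity.CodeFP
  Literature.Computability.Cryptography Literature.Computability.Cryptography.PeriodFinding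
  Literature.Computability.Cryptography.Kitaev1995 Literature.Computability.Cryptography.Shor1997
  Literature.Computability.Cryptography.OFPostCF Finset

variable (P : FParams) (n : ℕ)

/-! ### The read-out bits as positions of the output string -/

/-- The first output position of the block of test `(l, σ)` of unit `u`. [folklore] -/
def baseOf (u l : ℕ) (σ : Bool) : ℕ := n + (((Bn P n * σ.toNat) + (2 * Bn P n) * l) + Kn P n * u)

/-- The step of a test. [folklore] -/
theorem val_eK_symm (τ : TIdx (Lv P n) (Bn P n)) :
    (((eK P n).symm τ : Fin (Kn P n)) : ℕ) = ((τ.2.2 : ℕ) + Bn P n * τ.2.1.toNat) + (2 * Bn P n) * τ.1 := by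
  obtain ⟨l, σ, rep⟩ := τ
  have hσ : ((finTwoEquiv.symm σ : Fin 2) : ℕ) = σ.toNat := by cases σ <;> rfl
  show ((finProdFinEquiv (l, finProdFinEquiv (finTwoEquiv.symm σ, rep)) : Fin _) : ℕ) = _
  rw [finProdFinEquiv_apply_val, finProdFinEquiv_apply_val, hσ]

/-- **The structured read-out reads the output string** at `baseOf u l σ + rep`. [folklore] -/
theorem readOf_apply (y : List Bool) (u : Fin (nU P n)) (τ : TIdx (Lv P n) (Bn P n)) :
    readOf P n y u τ = y.getD (baseOf P n u τ.1 τ.2.1 + τ.2.2) false := by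
  show y.getD (n + ((finProdFinEquiv (u, (eK P n).symm τ) : Fin _) : ℕ)) false = _
  rw [finProdFinEquiv_apply_val, val_eK_symm]
  congr 1
  show n + (((τ.2.2 : ℕ) + Bn P n * τ.2.1.toNat) + (2 * Bn P n) * τ.1 + Kn P n * u) = _
  unfold baseOf
  ring

/-- **The block counts are ones of windows of the output string.** [cite: Kitaev1995, §3 (before Lemma 9)] -/
def cntN (y : List Bool) (u l : ℕ) (σ : Bool) : ℕ := ((y.drop (baseOf P n u l σ)).take (Bn P n)).count true

/-- The block counts of the read-out. [folklore] -/
theorem cntU_readOf (y : List Bool) (u : Fin (nU P n)) (l : Fin (Lv P n)) (σ : Bool) :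
    cntU (readOf P n y u) l σ = cntN P n y u l σ := by
  rw [cntN, count_take_drop_eq_sum, cntU]
  -- the block `(l, σ, ·)` is the image of `Fin B`
  have himg : (tblock l σ : Finset (TIdx (Lv P n) (Bn P n))) = (univ : Finset (Fin (Bn P n))).map
      ⟨fun rep => (l, σ, rep), fun a b h => by simpa using h⟩ := by
    ext τ
    simp only [mem_tblock, mem_map, mem_univ, true_and, Function.Embedding.coeFn_mk]
    constructor
    · rintro ⟨h1, h2⟩; exact ⟨τ.2.2, by rw [← h1, ← h2]⟩
    · rintro ⟨rep, rfl⟩; exact ⟨rfl, rfl⟩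
  rw [himg, filter_map, card_map, card_filter]
  refine sum_congr rfl fun rep _ => ?_
  simp only [Function.comp_apply, Function.Embedding.coeFn_mk, readOf_apply]
  cases y.getD (baseOf P n u l σ + rep) false <;> simp

/-! ### The estimate as an integer refinement -/

/-- The level numerators read off the counts (`0` beyond the levels). [cite: Kitaev1995, §3 Lemma 10] -/
def kapN (y : List Bool) (u l : ℕ) : ℕ :=
  if l < Lv P n then kq (decide (2 * cntN P n y u l false ≤ Bn P n)) (decide (2 * cntN P n y u l true ≤ Bn P n)) else 0

/-- Level numerators are `< 8`. [folklore] -/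
theorem kapN_lt (y : List Bool) (u l : ℕ) : kapN P n y u l < 8 := by
  unfold kapN; split_ifs
  · exact kq_lt _ _
  · norm_num

/-- The numerator of the phase estimate. [cite: Kitaev1995, §3 Lemma 10] -/
def AN (y : List Bool) (u : ℕ) : ℕ := refineNat (kapN P n y u) (Lv P n) (Lv P n - 1)

/-- The denominator of the phase estimate. [folklore] -/
def DN : ℕ := 8 * 2 ^ (Lv P n - 1)

/-- **The phase estimate of the read-out as a dyadic rational.** [cite: Kitaev1995, §3 Lemma 10] -/
theorem phaseEstU_readOf (y : List Bool) (u : Fin (nU P n)) :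
    phaseEstU (readOf P n y u) = (AN P n y u : ℚ) / DN P n := by
  have hDN : (DN P n : ℚ) = 8 * 2 ^ (Lv P n - 1) := by unfold DN; push_cast; ring
  rw [phaseEstU, refined, AN, hDN, ← refineAux_eq (kapN_lt P n y u)]
  congr 1
  funext l
  unfold kapN levelEstU
  by_cases h : l < Lv P n
  · rw [dif_pos h, if_pos h, quadrantCenter_eq, cntU_readOf, cntU_readOf]
  · rw [dif_neg h, if_neg h]; simp

/-- The rounded character in integers. [folklore] -/
def cEN (y : List Bool) (u Q : ℕ) : ℕ := ((2 * (AN P n y u * Q) + DN P n) / (2 * DN P n)) % Q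

/-- Rounding a nonnegative fraction. [folklore] -/
theorem round_div_eq (a : ℕ) {b : ℕ} (hb : 0 < b) : (round ((a : ℚ) / b) : ℤ) = ((2 * a + b) / (2 * b) : ℕ) := by
  rw [round_eq, show (a : ℚ) / b + 1 / 2 = ((2 * a + b : ℕ) : ℚ) / ((2 * b : ℕ) : ℚ) by
    push_cast; field_simp; try ring, Rat.floor_natCast_div_natCast]
  exact (Int.natCast_div _ _).symm

/-- **The rounded character of the read-out.** [folklore] -/
theorem cEst_readOf (y : List Bool) (u : Fin (nU P n)) (Q : ℕ) :
    cEst Q (readOf P n y u) = cEN P n y u Q := by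
  rw [cEst, phaseEstU_readOf, cEN]
  have hD : 0 < DN P n := by unfold DN; positivity
  rw [show (AN P n y u : ℚ) / DN P n * Q = ((AN P n y u * Q : ℕ) : ℚ) / DN P n by push_cast; ring,
    round_div_eq _ hD, ← Int.natCast_mod, Int.toNat_natCast]

/-! ### The candidate by continued fractions -/

/-- The candidate of unit `u` computed on the output string. [cite: Shor1997, §5] -/
def candN (y : List Bool) (u : ℕ) : ℕ :=
  cfCandidate (Nat.sqrt (2 ^ LofN n u)) (2 ^ LofN n u) (cEN P n y u (2 ^ LofN n u)) (2 ^ LofN n u) (2 * LofN n u + 3)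

/-- **The candidate of the read-out is the continued-fraction candidate.** [cite: Shor1997, §5] -/
theorem cand_readOf (y : List Bool) (u : Fin (nU P n)) : cand P n u (readOf P n y u) = candN P n y u := by
  have hL : (spec P n).L u = LofN n u := spec_L P n u
  have hQ : Qof (spec P n).L u = 2 ^ LofN n u := by rw [Qof, hL]
  rw [cand, candOf, nSof, hQ, cEst_readOf, candN]
  symm
  have h := cfCandidate_eq_candidate (n := Nat.sqrt (2 ^ LofN n u)) (q := 2 ^ LofN n u)
    (A := cEN P n y u (2 ^ LofN n u)) (D := 2 ^ LofN n u) (s := LofN n u + 1) (K := 2 * LofN n u + 3)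
    (Nat.sqrt_le' _) (Nat.two_pow_pos _) (Nat.pow_lt_pow_right (by norm_num) (by omega)) (by omega)
  rw [h, Nat.cast_pow, Nat.cast_ofNat]

/-! ### The two-hit test -/

/-- The two-hit test on the output string. [cite: AaronsonChen2017, App. 13 (proof of Lemma 7.5)] -/
def foundN (y : List Bool) : Bool :=
  (List.range (nL P n)).any fun li => (List.range 12).any fun t => (List.range 12).any fun t' =>
    (!decide (t = t')) && (decide (candN P n y (12 * li + t) = candN P n y (12 * li + t')) &&
      decide (2 ≤ candN P n y (12 * li + t)))

/-- The units of a length. [folklore] -/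
theorem mem_unitsOf_iff (li : Fin (nL P n)) (u : Fin (nU P n)) : u ∈ unitsOf P n li ↔ (u : ℕ) / 12 = li := by
  simp only [unitsOf, mem_filter, mem_univ, true_and]
  rw [Fin.ext_iff, val_eU_fst]

/-- **The two-hit test decides `Found`.** [cite: AaronsonChen2017, App. 13 (proof of Lemma 7.5)] -/
theorem found_iff (y : List Bool) : Found P n (readOf P n y) ↔ foundN P n y = true := by
  simp only [foundN, List.any_eq_true, List.mem_range, Bool.and_eq_true, Bool.not_eq_true', decide_eq_false_iff_not,
    decide_eq_true_eq]
  constructor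
  · rintro ⟨li, u, hu, u', hu', hne, heq, h2⟩
    rw [mem_unitsOf_iff] at hu hu'
    rw [cand_readOf, cand_readOf] at heq
    rw [cand_readOf] at h2
    have eu : 12 * (li : ℕ) + (u : ℕ) % 12 = u := by rw [← hu]; exact Nat.div_add_mod _ _
    have eu' : 12 * (li : ℕ) + (u' : ℕ) % 12 = u' := by rw [← hu']; exact Nat.div_add_mod _ _
    refine ⟨li, li.isLt, (u : ℕ) % 12, Nat.mod_lt _ (by norm_num), (u' : ℕ) % 12, Nat.mod_lt _ (by norm_num), ?_, ?_, ?_⟩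
    · intro h
      apply hne
      apply Fin.ext
      rw [← eu, ← eu', h]
    · rw [eu, eu']; exact heq
    · rw [eu]; exact h2
  · rintro ⟨li, hli, t, ht, t', ht', hne, heq, h2⟩
    have hu : 12 * li + t < nU P n := by unfold nU; omega
    have hu' : 12 * li + t' < nU P n := by unfold nU; omega
    refine ⟨⟨li, hli⟩, ⟨12 * li + t, hu⟩, ?_, ⟨12 * li + t', hu'⟩, ?_, ?_, ?_, ?_⟩
    · rw [mem_unitsOf_iff]; simp; omega
    · rw [mem_unitsOf_iff]; simp; omega
    · intro h; apply hne; have := congrArg Fin.val h; simp at this; omega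
    · rw [cand_readOf, cand_readOf]; exact heq
    · rw [cand_readOf]; exact h2

/-! ### The integer refinement as a capped left fold -/

/-- One step of the integer refinement (`OFPostCF.refineNat`), on data. [cite: Kitaev1995, §3 Lemma 10] -/
def stepR (κ : ℕ → ℕ) (L d a : ℕ) : ℕ :=
  let N := 8 * 2 ^ (d + 1)
  let v := κ (L - 1 - (d + 1)) * 2 ^ (d + 1)
  if md ((a + N - v) % N) N ≤ md ((a + N / 2 + N - v) % N) N then a else a + N / 2

/-- The integer refinement is a left fold of its steps. [folklore] -/
theorem refineNat_eq_foldl (κ : ℕ → ℕ) (L : ℕ) : ∀ d, refineNat κ L d = (List.range d).foldl (fun a d' => stepR κ L d' a) (κ (L - 1))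
  | 0 => rfl
  | d + 1 => by rw [List.range_succ, List.foldl_append, List.foldl_cons, List.foldl_nil, ← refineNat_eq_foldl κ L d]; rfl

/-- The capped step: exponent capped by `L`, result capped by `8 · 2^L` (neither cap binds along
the refinement). [folklore] -/
def stepC (κs : List ℕ) (L d a : ℕ) : ℕ :=
  let E := 2 ^ min (d + 1) L
  let N := 8 * E
  let v := κs.getD (L - 1 - (d + 1)) 0 * E
  min (if md ((a + N - v) % N) N ≤ md ((a + N / 2 + N - v) % N) N then a else a + N / 2) (8 * 2 ^ L)

/-- Along the refinement the capped step is the step. [folklore] -/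
theorem stepC_eq {κ : ℕ → ℕ} {κs : List ℕ} (hκs : ∀ l, κs.getD l 0 = κ l) {L d : ℕ} (hd : d + 1 ≤ L)
    {a : ℕ} (ha : a < 8 * 2 ^ d) : stepC κs L d a = stepR κ L d a := by
  unfold stepC stepR
  simp only [min_eq_left hd, hκs]
  rw [min_eq_left]
  have hN : 8 * 2 ^ (d + 1) / 2 = 8 * 2 ^ d := by rw [pow_succ]; omega
  have hle : 2 ^ (d + 1) ≤ 2 ^ L := Nat.pow_le_pow_right (by norm_num) hd
  split_ifs
  · calc a ≤ 8 * 2 ^ d := ha.le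
      _ ≤ 8 * 2 ^ L := by rw [pow_succ] at hle; omega
  · rw [hN, pow_succ] at *; omega

/-- **The refinement as the capped fold.** [cite: Kitaev1995, §3 Lemma 10] -/
theorem refineNat_eq_foldl_stepC {κ : ℕ → ℕ} (hκ : ∀ l, κ l < 8) {κs : List ℕ} (hκs : ∀ l, κs.getD l 0 = κ l) (L : ℕ) :
    ∀ d, d ≤ L - 1 → refineNat κ L d = (List.range d).foldl (fun a d' => stepC κs L d' a) (min (κs.getD (L - 1) 0) 7)
  | 0, _ => by
    rw [List.range_zero, List.foldl_nil, hκs, min_eq_left (by have := hκ (L - 1); omega)]; rfl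
  | d + 1, hd => by
    rw [List.range_succ, List.foldl_append, List.foldl_cons, List.foldl_nil, ← refineNat_eq_foldl_stepC hκ hκs L d (by omega),
      stepC_eq hκs (by omega) (refineNat_lt hκ L d), refineNat]
    rfl

/-! ### The post-processor on codes -/

section Program

variable (q : Polynomial ℕ)

/-- Contexts: `⟨x, y⟩`, `(⟨x, y⟩, u)`, `((⟨x, y⟩, u), l)`. [folklore] -/
abbrev G0E : List Bool × List Bool → List Bool := pairE strE strE
/-- Contexts. [folklore] -/
abbrev G1E : (List Bool × List Bool) × ℕ → List Bool := pairE G0E natE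
/-- Contexts. [folklore] -/
abbrev G2E : ((List Bool × List Bool) × ℕ) × ℕ → List Bool := pairE G1E natE

/-- Projections. [folklore] -/
theorem g0n : CodeFP G0E unE (fun c : List Bool × List Bool => c.1.length) := strLength.comp (fst strE strE)
/-- Projections. [folklore] -/
theorem g0y : CodeFP G0E strE (fun c : List Bool × List Bool => c.2) := snd strE strE
/-- Projections. [folklore] -/
theorem g1n : CodeFP G1E unE (fun c : (List Bool × List Bool) × ℕ => c.1.1.length) := g0n.comp (fst G0E natE)
/-- Projections. [folklore] -/
theorem g1y : CodeFP G1E strE (fun c : (List Bool × List Bool) × ℕ => c.1.2) := g0y.comp (fst G0E natE)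
/-- Projections. [folklore] -/
theorem g1u : CodeFP G1E natE (fun c : (List Bool × List Bool) × ℕ => c.2) := snd G0E natE
/-- Projections. [folklore] -/
theorem g2n : CodeFP G2E unE (fun c : ((List Bool × List Bool) × ℕ) × ℕ => c.1.1.1.length) := g1n.comp (fst G1E natE)
/-- Projections. [folklore] -/
theorem g2y : CodeFP G2E strE (fun c : ((List Bool × List Bool) × ℕ) × ℕ => c.1.1.2) := g1y.comp (fst G1E natE)
/-- Projections. [folklore] -/
theorem g2u : CodeFP G2E natE (fun c : ((List Bool × List Bool) × ℕ) × ℕ => c.1.2) := g1u.comp (fst G1E natE)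
/-- Projections. [folklore] -/
theorem g2l : CodeFP G2E natE (fun c : ((List Bool × List Bool) × ℕ) × ℕ => c.2) := snd G1E natE

/-- **A window of the output string**: `(y.drop b).take t` for a computed binary start `b` and a
computed unary length `t` (the drop count is capped by the length, `Lem75Q.drop_min_length`). [cite: AroraBarak2009, §1.3] -/
theorem window_fp {γ : Type} {eγ : γ → List Bool} {fy : γ → List Bool} {fb ft : γ → ℕ} (hy : CodeFP eγ strE fy)
    (hb : CodeFP eγ natE fb) (ht : CodeFP eγ unE ft) : CodeFP eγ strE (fun c => ((fy c).drop (fb c)).take (ft c)) :=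
  (strTake.comp (ht.pair (strDrop.comp ((unOfNatMin.comp ((strLength.comp hy).pair hb)).pair hy)))).congr fun c => by
    show ((fy c).drop (min (fb c) (fy c).length)).take (ft c) = _
    rw [Lem75Q.drop_min_length]

/-- **The block counts on codes** (`σ` fixed). [cite: Kitaev1995, §3 (before Lemma 9)] -/
theorem cnt_fp (σ : Bool) : CodeFP G2E natE (fun c : ((List Bool × List Bool) × ℕ) × ℕ =>
    cntN (ofPoly q) c.1.1.1.length c.1.1.2 c.1.2 c.2 σ) := by
  have hbase : CodeFP G2E natE (fun c => baseOf (ofPoly q) c.1.1.1.length c.1.2 c.2 σ) :=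
    (nadd' (natOfUn.comp g2n) (nadd' (nadd' (nmul' (size_nat (Bn_un q) g2n) (nconst' _ σ.toNat))
      (nmul' (nmul' (nconst' _ 2) (size_nat (Bn_un q) g2n)) g2l)) (nmul' (size_nat (Kn_un q) g2n) g2u))).congr fun _ => rfl
  exact (Lem75Q.strCount.comp (window_fp g2y hbase ((Bn_un q).comp g2n))).congr fun _ => rfl

/-- **The level numerators on codes.** [cite: Kitaev1995, §3 Lemma 10] -/
theorem kap_fp : CodeFP G2E natE (fun c : ((List Bool × List Bool) × ℕ) × ℕ => kapN (ofPoly q) c.1.1.1.length c.1.1.2 c.1.2 c.2) := by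
  have hB : CodeFP G2E natE (fun c => Bn (ofPoly q) c.1.1.1.length) := size_nat (Bn_un q) g2n
  have hb : ∀ σ, CodeFP G2E bitE (fun c => decide (2 * cntN (ofPoly q) c.1.1.1.length c.1.1.2 c.1.2 c.2 σ ≤
      Bn (ofPoly q) c.1.1.1.length)) := fun σ => nle' (nmul' (nconst' _ 2) (cnt_fp q σ)) hB
  have hkq : CodeFP G2E natE (fun c => kq (decide (2 * cntN (ofPoly q) c.1.1.1.length c.1.1.2 c.1.2 c.2 false ≤
      Bn (ofPoly q) c.1.1.1.length)) (decide (2 * cntN (ofPoly q) c.1.1.1.length c.1.1.2 c.1.2 c.2 true ≤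
      Bn (ofPoly q) c.1.1.1.length))) :=
    ((hb false).ite ((hb true).ite (nconst' _ 1) (nconst' _ 7)) ((hb true).ite (nconst' _ 3) (nconst' _ 5))).congr fun _ => rfl
  exact ((nlt' g2l (size_nat (Lv_un q) g2n)).ite hkq (nconst' _ 0)).congr fun c => by
    unfold kapN; by_cases h : c.2 < Lv (ofPoly q) c.1.1.1.length <;> simp [h]

/-- The list of level numerators of unit `u`. [folklore] -/
def kapsN (P : FParams) (n : ℕ) (y : List Bool) (u : ℕ) : List ℕ := (List.range (Lv P n)).map (kapN P n y u)

/-- The list holds the level numerators. [folklore] -/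
theorem getD_kapsN (P : FParams) (n : ℕ) (y : List Bool) (u l : ℕ) : (kapsN P n y u).getD l 0 = kapN P n y u l := by
  unfold kapsN
  rw [List.getD_eq_getElem?_getD, List.getElem?_map]
  by_cases h : l < Lv P n
  · rw [List.getElem?_range h]; rfl
  · rw [List.getElem?_eq_none (by simpa using h)]
    unfold kapN; rw [if_neg h]; rfl

/-- **The level numerators list on codes.** [folklore] -/
theorem kaps_fp : CodeFP G1E (rawE natE) (fun c : (List Bool × List Bool) × ℕ => kapsN (ofPoly q) c.1.1.length c.1.2 c.2) :=
  (mapRange ((Lv_un q).comp g1n) (kap_fp q)).congr fun _ => rfl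

/-- Modular distance on codes. [folklore] -/
theorem md_fp {γ : Type} {eγ : γ → List Bool} {fw fN : γ → ℕ} (hw : CodeFP eγ natE fw) (hN : CodeFP eγ natE fN) :
    CodeFP eγ natE (fun c => md (fw c) (fN c)) := (natMin.comp (hw.pair (nsub' hN hw))).congr fun _ => rfl

/-- The context of the fold: `(κs, 1^L)`. [folklore] -/
abbrev RCE : List ℕ × ℕ → List Bool := pairE (rawE natE) unE

/-- **The capped step on codes** (input `((κs, 1^L), (d, a))`). [cite: Kitaev1995, §3 Lemma 10] -/
theorem stepC_fp : CodeFP (pairE RCE (pairE natE natE)) natE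
    (fun t : (List ℕ × ℕ) × (ℕ × ℕ) => stepC t.1.1 t.1.2 t.2.1 t.2.2) := by
  have hL : CodeFP (pairE RCE (pairE natE natE)) unE (fun t => t.1.2) := (snd _ _).comp (fst _ _)
  have hκ : CodeFP (pairE RCE (pairE natE natE)) (rawE natE) (fun t => t.1.1) := (fst _ _).comp (fst _ _)
  have hd : CodeFP (pairE RCE (pairE natE natE)) natE (fun t => t.2.1) := (fst _ _).comp (snd _ _)
  have ha : CodeFP (pairE RCE (pairE natE natE)) natE (fun t => t.2.2) := (snd _ _).comp (snd _ _)
  have hE : CodeFP (pairE RCE (pairE natE natE)) natE (fun t => 2 ^ min (t.2.1 + 1) t.1.2) :=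
    natPow.comp ((nconst' _ 2).pair (unOfNatMin.comp (hL.pair (nadd' hd (nconst' _ 1)))))
  have hN : CodeFP (pairE RCE (pairE natE natE)) natE (fun t => 8 * 2 ^ min (t.2.1 + 1) t.1.2) := nmul' (nconst' _ 8) hE
  have hv : CodeFP (pairE RCE (pairE natE natE)) natE (fun t => t.1.1.getD (t.1.2 - 1 - (t.2.1 + 1)) 0 * 2 ^ min (t.2.1 + 1) t.1.2) :=
    nmul' ((rawGetD natE rfl).comp (hκ.pair (nsub' (nsub' (natOfUn.comp hL) (nconst' _ 1)) (nadd' hd (nconst' _ 1))))) hE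
  have h1 : CodeFP (pairE RCE (pairE natE natE)) natE (fun t => md ((t.2.2 + 8 * 2 ^ min (t.2.1 + 1) t.1.2 -
      t.1.1.getD (t.1.2 - 1 - (t.2.1 + 1)) 0 * 2 ^ min (t.2.1 + 1) t.1.2) % (8 * 2 ^ min (t.2.1 + 1) t.1.2))
      (8 * 2 ^ min (t.2.1 + 1) t.1.2)) := md_fp (nmod' (nsub' (nadd' ha hN) hv) hN) hN
  have h2 : CodeFP (pairE RCE (pairE natE natE)) natE (fun t => md ((t.2.2 + 8 * 2 ^ min (t.2.1 + 1) t.1.2 / 2 +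
      8 * 2 ^ min (t.2.1 + 1) t.1.2 - t.1.1.getD (t.1.2 - 1 - (t.2.1 + 1)) 0 * 2 ^ min (t.2.1 + 1) t.1.2) %
      (8 * 2 ^ min (t.2.1 + 1) t.1.2)) (8 * 2 ^ min (t.2.1 + 1) t.1.2)) :=
    md_fp (nmod' (nsub' (nadd' (nadd' ha (ndiv' hN (nconst' _ 2))) hN) hv) hN) hN
  have hcap : CodeFP (pairE RCE (pairE natE natE)) natE (fun t => 8 * 2 ^ t.1.2) :=
    nmul' (nconst' _ 8) (natPow.comp ((nconst' _ 2).pair hL))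
  exact (natMin.comp (((nle' h1 h2).ite ha (nadd' ha (ndiv' hN (nconst' _ 2)))).pair hcap)).congr fun t => by
    by_cases h : md ((t.2.2 + 8 * 2 ^ min (t.2.1 + 1) t.1.2 - t.1.1.getD (t.1.2 - 1 - (t.2.1 + 1)) 0 * 2 ^ min (t.2.1 + 1) t.1.2) %
        (8 * 2 ^ min (t.2.1 + 1) t.1.2)) (8 * 2 ^ min (t.2.1 + 1) t.1.2) ≤
        md ((t.2.2 + 8 * 2 ^ min (t.2.1 + 1) t.1.2 / 2 + 8 * 2 ^ min (t.2.1 + 1) t.1.2 -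
          t.1.1.getD (t.1.2 - 1 - (t.2.1 + 1)) 0 * 2 ^ min (t.2.1 + 1) t.1.2) % (8 * 2 ^ min (t.2.1 + 1) t.1.2))
          (8 * 2 ^ min (t.2.1 + 1) t.1.2) <;>
      simp only [stepC, h, decide_true, decide_false, if_true, if_false, Bool.false_eq_true]

/-- **The capped refinement fold on codes** (input `((κs, 1^L), ds)`). [cite: Kitaev1995, §3 Lemma 10] [cite: AroraBarak2009, §1.3] -/
theorem foldC_fp : CodeFP (pairE RCE (rawE natE)) natE (fun t : (List ℕ × ℕ) × List ℕ =>
    List.foldl (fun (a d : ℕ) => stepC t.1.1 t.1.2 d a) (min (t.1.1.getD (t.1.2 - 1) 0) 7) t.2) := by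
  refine CodeFP.foldl (step := fun (s : List ℕ × ℕ) (d a : ℕ) => stepC s.1 s.2 d a)
    (init := fun s => min (s.1.getD (s.2 - 1) 0) 7)
    stepC_fp (natMin.comp (((rawGetD natE rfl).comp ((fst _ _).pair (nsub' (natOfUn.comp (snd _ _)) (nconst' _ 1)))).pair
      (nconst' _ 7))) (Polynomial.X + 4) ?_
  intro s l₁ l₂
  rw [Polynomial.eval_add, Polynomial.eval_X, Polynomial.eval_ofNat]
  -- the accumulator is `< 2^{L+4}` (initially `≤ 7`, then capped by the step)
  have hacc : ∀ l : List ℕ, List.foldl (fun (a d : ℕ) => stepC s.1 s.2 d a) (min (s.1.getD (s.2 - 1) 0) 7) l < 2 ^ (s.2 + 4) := by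
    intro l
    induction l using List.reverseRecOn with
    | nil =>
      rw [List.foldl_nil]
      exact lt_of_le_of_lt (min_le_right _ _) (by
        have : (16 : ℕ) ≤ 2 ^ (s.2 + 4) := by rw [pow_add]; norm_num; exact Nat.one_le_two_pow
        omega)
    | append_singleton l d ih =>
      rw [List.foldl_append, List.foldl_cons, List.foldl_nil]
      have hcap : 8 * 2 ^ s.2 < 2 ^ (s.2 + 4) := by
        rw [pow_add]; have := Nat.two_pow_pos s.2; norm_num; omega
      exact lt_of_le_of_lt (min_le_right _ _) hcap
  refine (show (natE _).length ≤ s.2 + 4 by rw [length_natE]; exact Nat.size_le.2 (hacc l₁)).trans ?_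
  have : s.2 ≤ (pairE RCE (rawE natE) (s, l₁ ++ l₂)).length := by
    show s.2 ≤ (boolPair (boolPair (rawE natE s.1) (unE s.2)) (rawE natE (l₁ ++ l₂))).length
    rw [length_boolPair, length_boolPair, length_unE]; omega
  omega

/-- **The numerator of the phase estimate on codes.** [cite: Kitaev1995, §3 Lemma 10] -/
theorem AN_fp : CodeFP G1E natE (fun c : (List Bool × List Bool) × ℕ => AN (ofPoly q) c.1.1.length c.1.2 c.2) := by
  have hLm : CodeFP G1E unE (fun c => Lv (ofPoly q) c.1.1.length - 1) :=
    (uadd' g1n ((nL_un q).comp g1n)).congr fun c => by unfold Lv; omega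
  refine (foldC_fp.comp (((kaps_fp q).pair ((Lv_un q).comp g1n)).pair (urange.comp hLm))).congr fun c => ?_
  exact (refineNat_eq_foldl_stepC (kapN_lt (ofPoly q) c.1.1.length c.1.2 c.2) (getD_kapsN (ofPoly q) c.1.1.length c.1.2 c.2)
    (Lv (ofPoly q) c.1.1.length) (Lv (ofPoly q) c.1.1.length - 1) le_rfl).symm

/-- `2^{L_u}` on codes (capped block length). [folklore] -/
theorem QC_fp : CodeFP G1E natE (fun c : (List Bool × List Bool) × ℕ => 2 ^ LofC q c.1.1.length c.2) :=
  natPow.comp ((nconst' _ 2).pair (LofC_un q g1n g1u))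

/-- The denominator on codes. [folklore] -/
theorem DN_fp : CodeFP G1E natE (fun c : (List Bool × List Bool) × ℕ => DN (ofPoly q) c.1.1.length) := by
  have hLm : CodeFP G1E unE (fun c => Lv (ofPoly q) c.1.1.length - 1) :=
    (uadd' g1n ((nL_un q).comp g1n)).congr fun c => by unfold Lv; omega
  exact (nmul' (nconst' _ 8) (natPow.comp ((nconst' _ 2).pair hLm))).congr fun _ => rfl

/-- **The rounded character on codes.** [folklore] -/
theorem cEN_fp : CodeFP G1E natE (fun c : (List Bool × List Bool) × ℕ =>
    cEN (ofPoly q) c.1.1.length c.1.2 c.2 (2 ^ LofC q c.1.1.length c.2)) :=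
  (nmod' (ndiv' (nadd' (nmul' (nconst' _ 2) (nmul' (AN_fp q) (QC_fp q))) (DN_fp q)) (nmul' (nconst' _ 2) (DN_fp q)))
    (QC_fp q)).congr fun _ => rfl

/-- The code of the arguments of the continued-fraction scan. [folklore] -/
abbrev X4E : ℕ × ℕ × ℕ × ℕ → List Bool := pairE natE (pairE natE (pairE natE natE))

/-- **Shor's candidate by continued fractions on codes** (`OFPostB.cfScanF`). [cite: Shor1997, §5] -/
theorem cf_fp {γ : Type} {eγ : γ → List Bool} {fn fq fA fD fK : γ → ℕ}
    (hx : CodeFP eγ X4E (fun c => (fn c, 2 * fq c, fA c, fD c))) (hK : CodeFP eγ unE fK) :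
    CodeFP eγ natE (fun c => cfCandidate (fn c) (fq c) (fA c) (fD c) (fK c)) := by
  obtain ⟨F, hF, hFs⟩ := hx.pair hK
  refine ⟨OFPostB.cfScanF ∘ F, comp_mem_FP OFPostB.cfScanF_mem_FP hF, fun c => ?_⟩
  rw [Function.comp_apply, hFs, show pairE X4E unE ((fn c, 2 * fq c, fA c, fD c), fK c) =
    boolPair (OFPostB.xrec (fn c) (fq c) (fA c) (fD c)) (unE (fK c)) from rfl, OFPostB.cfScanF_apply, length_unE]

/-- The candidate of unit `u` with the capped block length. [folklore] -/
def candC (n : ℕ) (y : List Bool) (u : ℕ) : ℕ :=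
  cfCandidate (Nat.sqrt (2 ^ LofC q n u)) (2 ^ LofC q n u) (cEN (ofPoly q) n y u (2 ^ LofC q n u)) (2 ^ LofC q n u)
    (2 * LofC q n u + 3)

/-- On the units the capped candidate is the candidate. [folklore] -/
theorem candC_eq {n : ℕ} (y : List Bool) {u : ℕ} (hu : u < nU (ofPoly q) n) : candC q n y u = candN (ofPoly q) n y u := by
  unfold candC candN
  rw [LofC_eq q hu]

/-- **The candidate on codes.** [cite: Shor1997, §5] -/
theorem cand_fp : CodeFP G1E natE (fun c : (List Bool × List Bool) × ℕ => candC q c.1.1.length c.1.2 c.2) := by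
  have hK : CodeFP G1E unE (fun c => 2 * LofC q c.1.1.length c.2 + 3) :=
    (unSucc.comp (unSucc.comp (unSucc.comp (uadd' (LofC_un q g1n g1u) (LofC_un q g1n g1u))))).congr fun _ => by omega
  exact (cf_fp ((natSqrt.comp (QC_fp q)).pair ((nmul' (nconst' _ 2) (QC_fp q)).pair ((cEN_fp q).pair (QC_fp q)))) hK).congr
    fun _ => rfl

/-- **The list of the candidates of the units on codes.** [folklore] -/
theorem cands_fp : CodeFP G0E (rawE natE) (fun c : List Bool × List Bool =>
    (List.range (nU (ofPoly q) c.1.length)).map (candN (ofPoly q) c.1.length c.2)) :=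
  (mapRange ((nU_un q).comp g0n) (cand_fp q)).congr fun c => List.map_congr_left fun _ hu => candC_eq q c.2 (List.mem_range.1 hu)

/-- The two-hit test on the list of candidates. [folklore] -/
def foundL (nl : ℕ) (cs : List ℕ) : Bool :=
  (List.range nl).any fun li => (List.range 12).any fun t => (List.range 12).any fun t' =>
    (!decide (t = t')) && (decide (cs.getD (12 * li + t) 0 = cs.getD (12 * li + t') 0) && decide (2 ≤ cs.getD (12 * li + t) 0))

/-- The two-hit test reads the list of candidates. [folklore] -/
theorem foundN_eq (P : FParams) (n : ℕ) (y : List Bool) :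
    foundN P n y = foundL (nL P n) ((List.range (nU P n)).map (candN P n y)) := by
  unfold foundN foundL
  have hget : ∀ {li t : ℕ}, li < nL P n → t < 12 →
      ((List.range (nU P n)).map (candN P n y)).getD (12 * li + t) 0 = candN P n y (12 * li + t) := by
    intro li t hli ht
    have h : 12 * li + t < nU P n := by unfold nU; omega
    rw [List.getD_eq_getElem?_getD, List.getElem?_map, List.getElem?_range h]; rfl
  rw [Bool.eq_iff_iff]
  simp only [List.any_eq_true, List.mem_range, Bool.and_eq_true, Bool.not_eq_true', decide_eq_false_iff_not,
    decide_eq_true_eq]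
  constructor
  · rintro ⟨li, hli, t, ht, t', ht', hne, heq, h2⟩
    exact ⟨li, hli, t, ht, t', ht', hne, by rwa [hget hli ht, hget hli ht'], by rwa [hget hli ht]⟩
  · rintro ⟨li, hli, t, ht, t', ht', hne, heq, h2⟩
    exact ⟨li, hli, t, ht, t', ht', hne, by rwa [hget hli ht, hget hli ht'] at heq, by rwa [hget hli ht] at h2⟩

/-- **The two-hit test on codes.** [cite: AaronsonChen2017, App. 13 (proof of Lemma 7.5)] -/
theorem foundL_fp : CodeFP (pairE unE (rawE natE)) bitE (fun c : ℕ × List ℕ => foundL c.1 c.2) := by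
  -- contexts `((1^{nl}, cs), li)`, `(_, t)`, `(_, t')`
  have hcs3 : CodeFP (pairE (pairE (pairE (pairE unE (rawE natE)) natE) natE) natE) (rawE natE)
      (fun d => d.1.1.1.2) := (snd _ _).comp ((fst _ _).comp ((fst _ _).comp (fst _ _)))
  have hli3 : CodeFP (pairE (pairE (pairE (pairE unE (rawE natE)) natE) natE) natE) natE (fun d => d.1.1.2) :=
    (snd _ _).comp ((fst _ _).comp (fst _ _))
  have ht3 : CodeFP (pairE (pairE (pairE (pairE unE (rawE natE)) natE) natE) natE) natE (fun d => d.1.2) :=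
    (snd _ _).comp (fst _ _)
  have ht'3 : CodeFP (pairE (pairE (pairE (pairE unE (rawE natE)) natE) natE) natE) natE (fun d => d.2) := snd _ _
  have hidx : ∀ {f : (((ℕ × List ℕ) × ℕ) × ℕ) × ℕ → ℕ}, CodeFP _ natE f →
      CodeFP (pairE (pairE (pairE (pairE unE (rawE natE)) natE) natE) natE) natE
        (fun d => d.1.1.1.2.getD (12 * d.1.1.2 + f d) 0) := fun hf =>
    (rawGetD natE rfl).comp (hcs3.pair (nadd' (nmul' (nconst' _ 12) hli3) hf))
  have htest : CodeFP (pairE (pairE (pairE (pairE unE (rawE natE)) natE) natE) natE) bitE (fun d =>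
      (!decide (d.1.2 = d.2)) && (decide (d.1.1.1.2.getD (12 * d.1.1.2 + d.1.2) 0 = d.1.1.1.2.getD (12 * d.1.1.2 + d.2) 0) &&
        decide (2 ≤ d.1.1.1.2.getD (12 * d.1.1.2 + d.1.2) 0))) :=
    (neq' ht3 ht'3).not.and ((neq' (hidx ht3) (hidx ht'3)).and (nle' (nconst' _ 2) (hidx ht3)))
  have h3 := (any htest).comp ((CodeFP.id _).pair (const _ (List.range 12)))
  have h2 := (any h3).comp ((CodeFP.id _).pair (const _ (List.range 12)))
  exact ((any h2).comp ((CodeFP.id _).pair (urange.comp (fst unE (rawE natE))))).congr fun _ => rfl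

/-- **The post-processor's decision bit on codes**: `|x| < n₀ ∨ ¬ Found`. [cite: AaronsonChen2017, App. 13] -/
theorem post_fp (n₀ : ℕ) : CodeFP G0E bitE (fun c : List Bool × List Bool =>
    decide (c.1.length < n₀) || !foundN (ofPoly q) c.1.length c.2) := by
  have hf : CodeFP G0E bitE (fun c : List Bool × List Bool => foundN (ofPoly q) c.1.length c.2) :=
    (foundL_fp.comp (((nL_un q).comp g0n).pair (cands_fp q))).congr fun c => (foundN_eq (ofPoly q) c.1.length c.2).symm
  exact (nlt' (natOfUn.comp g0n) (nconst' _ n₀)).or hf.not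

/-- **The post-processor** of the distinguisher with threshold `n₀`. [cite: AaronsonChen2017, App. 13] -/
def postFn (n₀ : ℕ) : List Bool → List Bool := Classical.choose (post_fp q n₀)

/-- The post-processor is polynomial time. [cite: AroraBarak2009, §1.3] -/
theorem postFn_mem_FP (n₀ : ℕ) : postFn q n₀ ∈ FP := (Classical.choose_spec (post_fp q n₀)).1

/-- **The post-processor's output**: the single bit `|x| < n₀ ∨ ¬ Found`. [cite: AaronsonChen2017, App. 13] -/
theorem postFn_apply (n₀ : ℕ) (x y : List Bool) :
    postFn q n₀ (boolPair x y) = [decide (x.length < n₀) || !decide (Found (ofPoly q) x.length (readOf (ofPoly q) x.length y))] := by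
  have h : postFn q n₀ (boolPair x y) = [decide (x.length < n₀) || !foundN (ofPoly q) x.length y] :=
    (Classical.choose_spec (post_fp q n₀)).2 (x, y)
  have hb : foundN (ofPoly q) x.length y = decide (Found (ofPoly q) x.length (readOf (ofPoly q) x.length y)) := by
    rw [Bool.eq_iff_iff, decide_eq_true_iff]
    exact (found_iff (ofPoly q) x.length y).symm
  rw [h, hb]

end Program

end Literature.Barriers.QuantumAdvantage

end
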